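import Mathlib
import HarnessLib

/-!
# ζ(5) search — `p`-adic slope bounds for the coefficients of rational power series

Cell `pub-zeta5` (HONEST FRAMING: systematic search; no irrationality claim unless certified), typer seat
generation 8.  A small self-contained calculus used by the Lean proof of gen-2's CLUSTER BOUND (Theorem A,
`ClusterValuation.ClusterBound`) and of its companions (Theorem A′, `ClassVBound`):

`CoeffBound p r M F` (for `F : ℚ⟦X⟧`, a slope `r : ℤ` and an offset `M : ℤ`) says
`‖[X^k] F‖_p ≤ p^{r·k − M}` for every `k`, i.e. `v_p([X^k] F) ≥ M − r·k`.
Slope `r = 0` is plain `p`-integrality of all coefficients (with `M` extra factors of `p`); slope `r = 1`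
says that `p^{−M} F(pX)` has `p`-integral coefficients.  The predicate is closed under products
(`CoeffBound.mul`, `.prod`, `.pow`, offsets add), is satisfied by constants and linear factors `X + c` with the
obvious offsets (`coeffBound_C`, `coeffBound_X_add_C`), passes to INVERSES when the constant coefficient has the
exact norm `p^{−M}` (`CoeffBound.of_mul_eq_one`, the non-archimedean recursion for the inverse), and yields
valuation bounds for individual non-zero coefficients (`CoeffBound.le_padicValRat`).
Nothing here is specific to the ζ(5) search and nothing is a cited fact.
-/

noncomputable section

open Finset PowerSeries

namespace Summit.KontsevichZagierPeriods.Zeta5Search.PadicSeries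

/-- **Slope bound.** `CoeffBound p r M F`: `‖[X^k] F‖_p ≤ p^{r k − M}` for all `k` (so `v_p([X^k]F) ≥ M − r k`). -/
def CoeffBound (p : ℕ) (r M : ℤ) (F : PowerSeries ℚ) : Prop :=
  ∀ k : ℕ, padicNorm p (coeff k F) ≤ (p : ℚ) ^ (r * k - M)

variable {p : ℕ} [hp : Fact p.Prime]

omit hp in
/-- Unfolding lemma. -/
theorem coeffBound_iff {r M : ℤ} {F : PowerSeries ℚ} :
    CoeffBound p r M F ↔ ∀ k : ℕ, padicNorm p (coeff k F) ≤ (p : ℚ) ^ (r * k - M) := Iff.rfl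

/-- `1 ≤ p` in `ℚ`. -/
theorem one_le_p : (1 : ℚ) ≤ p := by exact_mod_cast hp.out.one_lt.le

/-- `1 < p` in `ℚ`. -/
theorem one_lt_p : (1 : ℚ) < p := by exact_mod_cast hp.out.one_lt

omit hp in
/-- Powers of `p` are non-negative. -/
theorem zpow_p_nonneg (e : ℤ) : (0 : ℚ) ≤ (p : ℚ) ^ e := zpow_nonneg (Nat.cast_nonneg p) e

/-- Weakening the offset. -/
theorem CoeffBound.mono {r M M' : ℤ} {F : PowerSeries ℚ} (h : CoeffBound p r M F) (hM : M' ≤ M) :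
    CoeffBound p r M' F := fun k =>
  (h k).trans (zpow_le_zpow_right₀ one_le_p (by omega))

/-- **Products**: offsets add. -/
theorem CoeffBound.mul {r M M' : ℤ} {F G : PowerSeries ℚ} (hF : CoeffBound p r M F)
    (hG : CoeffBound p r M' G) : CoeffBound p r (M + M') (F * G) := by
  intro k
  rw [coeff_mul]
  refine padicNorm.sum_le' (fun ij hij => ?_) (zpow_p_nonneg _)
  have hk : ij.1 + ij.2 = k := mem_antidiagonal.1 hij
  rw [padicNorm.mul]
  calc padicNorm p (coeff ij.1 F) * padicNorm p (coeff ij.2 G)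
      ≤ (p : ℚ) ^ (r * ij.1 - M) * (p : ℚ) ^ (r * ij.2 - M') :=
        mul_le_mul (hF _) (hG _) (padicNorm.nonneg _) (zpow_p_nonneg _)
    _ = (p : ℚ) ^ (r * k - (M + M')) := by
        rw [← zpow_add₀ (Nat.cast_ne_zero.2 hp.out.ne_zero), ← hk]; push_cast; ring_nf

omit hp in
/-- The constant series `1`. -/
theorem coeffBound_one {r : ℤ} : CoeffBound p r 0 (1 : PowerSeries ℚ) := by
  intro k
  rw [coeff_one]
  split_ifs with hk
  · subst hk; simp
  · rw [padicNorm.zero]; exact zpow_p_nonneg _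

/-- **Finite products**: offsets add. -/
theorem CoeffBound.prod {ι : Type*} {r : ℤ} (s : Finset ι) (M : ι → ℤ)
    (F : ι → PowerSeries ℚ) (h : ∀ i ∈ s, CoeffBound p r (M i) (F i)) :
    CoeffBound p r (∑ i ∈ s, M i) (∏ i ∈ s, F i) := by
  classical
  induction s using Finset.induction_on with
  | empty => simpa using (coeffBound_one : CoeffBound p r 0 1)
  | insert a s ha ih =>
    rw [sum_insert ha, prod_insert ha]
    exact (h a (mem_insert_self a s)).mul (ih fun i hi => h i (mem_insert_of_mem hi))

/-- **Powers**. -/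
theorem CoeffBound.pow {r M : ℤ} {F : PowerSeries ℚ} (h : CoeffBound p r M F) (m : ℕ) :
    CoeffBound p r (m * M) (F ^ m) := by
  induction m with
  | zero => simpa using (coeffBound_one : CoeffBound p r 0 1)
  | succ m ih =>
    rw [pow_succ]
    have := ih.mul h
    convert this using 2
    push_cast; ring

omit hp in
/-- **Constants**: `‖c‖_p ≤ p^{−M}` gives offset `M`. -/
theorem coeffBound_C {r M : ℤ} {c : ℚ} (hc : padicNorm p c ≤ (p : ℚ) ^ (-M)) :
    CoeffBound p r M (C c) := by
  intro k
  rw [coeff_C]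
  split_ifs with hk
  · subst hk; simpa using hc
  · rw [padicNorm.zero]; exact zpow_p_nonneg _

/-- **Linear factors**: `‖c‖_p ≤ p^{−M}` and `M ≤ r` give offset `M` for `X + c`. -/
theorem coeffBound_X_add_C {r M : ℤ} (hMr : M ≤ r) {c : ℚ} (hc : padicNorm p c ≤ (p : ℚ) ^ (-M)) :
    CoeffBound p r M (X + C c) := by
  intro k
  rw [map_add, coeff_X, coeff_C]
  rcases Nat.lt_trichotomy k 1 with hk | rfl | hk
  · have hk0 : k = 0 := by omega
    subst hk0
    simpa using hc
  · simp only [if_true, one_ne_zero, if_false, add_zero, padicNorm.one, Nat.cast_one, mul_one]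
    exact one_le_zpow₀ one_le_p (by omega)
  · rw [if_neg (by omega), if_neg (by omega), add_zero, padicNorm.zero]
    exact zpow_p_nonneg _

/-- `2X + c` with `‖c‖_p ≤ p^{−M}`, `M ≤ r`, at an odd prime. -/
theorem coeffBound_two_X_add_C {r M : ℤ} (hMr : M ≤ r) (hp2 : p ≠ 2) {c : ℚ}
    (hc : padicNorm p c ≤ (p : ℚ) ^ (-M)) : CoeffBound p r M (C 2 * X + C c) := by
  intro k
  rw [map_add, coeff_C_mul, coeff_X, coeff_C]
  have h2 : padicNorm p (2 : ℚ) = 1 := by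
    have := (padicNorm.nat_eq_one_iff (p := p) 2).2 (by
      intro h
      have := (Nat.prime_dvd_prime_iff_eq hp.out Nat.prime_two).1 h
      exact hp2 this)
    exact_mod_cast this
  rcases Nat.lt_trichotomy k 1 with hk | rfl | hk
  · have hk0 : k = 0 := by omega
    subst hk0
    simpa using hc
  · simp only [if_true, one_ne_zero, if_false, add_zero, mul_one, Nat.cast_one, h2]
    exact one_le_zpow₀ one_le_p (by omega)
  · rw [if_neg (by omega), if_neg (by omega), mul_zero, add_zero, padicNorm.zero]
    exact zpow_p_nonneg _

/-- **Inverses.** If `F` has slope bound `(r, M)` with the EXACT constant norm `‖F(0)‖_p = p^{−M}` and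
`F · G = 1`, then `G` has slope bound `(r, −M)` (non-archimedean recursion for the coefficients of `G`). -/
theorem CoeffBound.of_mul_eq_one {r M : ℤ} {F G : PowerSeries ℚ} (hF : CoeffBound p r M F)
    (h0 : padicNorm p (coeff 0 F) = (p : ℚ) ^ (-M)) (hFG : F * G = 1) :
    CoeffBound p r (-M) G := by
  have hF0 : coeff 0 F ≠ 0 := by
    intro h
    rw [h, padicNorm.zero] at h0
    exact (zpow_ne_zero (-M) (Nat.cast_ne_zero.2 hp.out.ne_zero)) h0.symm
  -- the recursion: F₀ G_k = [k = 0] − Σ_{i<k} F_{i+1} G_{k-1-i}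
  have hrec : ∀ k, coeff 0 F * coeff k G =
      (if k = 0 then 1 else 0) - ∑ i ∈ range k, coeff (i + 1) F * coeff (k - 1 - i) G := by
    intro k
    have h := congrArg (coeff k) hFG
    rw [coeff_mul, coeff_one, Nat.sum_antidiagonal_eq_sum_range_succ_mk, sum_range_succ'] at h
    simp only [Nat.sub_zero] at h
    rw [← h]
    have : ∀ i ∈ range k, coeff (i + 1) F * coeff (k - (i + 1)) G = coeff (i + 1) F * coeff (k - 1 - i) G := by
      intro i _
      rw [show k - (i + 1) = k - 1 - i by omega]
    rw [sum_congr rfl this]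
    ring
  intro k
  induction k using Nat.strong_induction_on with
  | _ k ih =>
    -- bound F₀ G_k
    have hprod : padicNorm p (coeff 0 F * coeff k G) ≤ (p : ℚ) ^ (r * k) := by
      rw [hrec k]
      refine (padicNorm.sub (p := p)).trans (max_le ?_ ?_)
      · split_ifs with hk
        · subst hk; simp
        · rw [padicNorm.zero]; exact zpow_p_nonneg _
      · refine padicNorm.sum_le' (fun i hi => ?_) (zpow_p_nonneg _)
        have hi' := mem_range.1 hi
        rw [padicNorm.mul]
        calc padicNorm p (coeff (i + 1) F) * padicNorm p (coeff (k - 1 - i) G)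
            ≤ (p : ℚ) ^ (r * (i + 1 : ℕ) - M) * (p : ℚ) ^ (r * (k - 1 - i : ℕ) - -M) :=
              mul_le_mul (hF _) (ih _ (by omega)) (padicNorm.nonneg _) (zpow_p_nonneg _)
          _ = (p : ℚ) ^ (r * k) := by
              rw [← zpow_add₀ (Nat.cast_ne_zero.2 hp.out.ne_zero)]
              congr 1
              have : ((k - 1 - i : ℕ) : ℤ) = k - 1 - i := by omega
              rw [this]; push_cast; ring
    have hG : padicNorm p (coeff k G) = padicNorm p (coeff 0 F * coeff k G) / padicNorm p (coeff 0 F) := by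
      rw [padicNorm.mul, mul_div_cancel_left₀ _ ((padicNorm.nonzero (p := p)) hF0)]
    rw [hG, h0, div_le_iff₀ (zpow_pos (by exact_mod_cast hp.out.pos) _)]
    calc padicNorm p (coeff 0 F * coeff k G) ≤ (p : ℚ) ^ (r * k) := hprod
      _ = (p : ℚ) ^ (r * k - -M) * (p : ℚ) ^ (-M) := by
          rw [← zpow_add₀ (Nat.cast_ne_zero.2 hp.out.ne_zero)]; congr 1; ring

/-- The constant coefficient of a product with slope bounds and exact constant norms has the exact norm. -/
theorem padicNorm_coeff_zero_prod {ι : Type*} (s : Finset ι) (M : ι → ℤ) (F : ι → PowerSeries ℚ)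
    (h : ∀ i ∈ s, padicNorm p (coeff 0 (F i)) = (p : ℚ) ^ (-M i)) :
    padicNorm p (coeff 0 (∏ i ∈ s, F i)) = (p : ℚ) ^ (-∑ i ∈ s, M i) := by
  classical
  induction s using Finset.induction_on with
  | empty => simp
  | insert a s ha ih =>
    rw [prod_insert ha, sum_insert ha, coeff_zero_eq_constantCoeff_apply, map_mul,
      ← coeff_zero_eq_constantCoeff_apply, ← coeff_zero_eq_constantCoeff_apply, padicNorm.mul,
      h a (mem_insert_self a s), ih fun i hi => h i (mem_insert_of_mem hi), ← zpow_add₀ (Nat.cast_ne_zero.2 hp.out.ne_zero)]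
    congr 1; ring

/-- The constant coefficient of a power. -/
theorem padicNorm_coeff_zero_pow {M : ℤ} {F : PowerSeries ℚ}
    (h : padicNorm p (coeff 0 F) = (p : ℚ) ^ (-M)) (m : ℕ) :
    padicNorm p (coeff 0 (F ^ m)) = (p : ℚ) ^ (-(m * M)) := by
  rw [coeff_zero_eq_constantCoeff_apply, map_pow, ← coeff_zero_eq_constantCoeff_apply]
  have : padicNorm p (coeff 0 F ^ m) = padicNorm p (coeff 0 F) ^ m := by
    induction m with
    | zero => simp
    | succ m ih => rw [pow_succ, padicNorm.mul, ih, pow_succ]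
  rw [this, h, ← zpow_natCast, ← zpow_mul]
  congr 1; ring

/-- **Extraction**: a non-zero coefficient of a series with slope bound `(r, M)` has `v_p ≥ M − r k`. -/
theorem CoeffBound.le_padicValRat {r M : ℤ} {F : PowerSeries ℚ} (h : CoeffBound p r M F) {k : ℕ}
    (hk : coeff k F ≠ 0) : M - r * k ≤ padicValRat p (coeff k F) := by
  have := h k
  rw [padicNorm.eq_zpow_of_nonzero hk, zpow_le_zpow_iff_right₀ one_lt_p] at this
  omega

omit hp in
/-- Slope-`0` bound with offset `0` is `p`-integrality: `‖[X^k]F‖_p ≤ 1`. -/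
theorem CoeffBound.norm_le_one {F : PowerSeries ℚ} (h : CoeffBound p 0 0 F) (k : ℕ) :
    padicNorm p (coeff k F) ≤ 1 := by
  simpa using h k

end Summit.KontsevichZagierPeriods.Zeta5Search.PadicSeries

end
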